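import Literature.AnabelianGeometry.EtaleTheta.DivisorMonoidsOfGaloisCoveringCoset
import Literature.AnabelianGeometry.EtaleTheta.RealifiedDivisorMonoidsOfRlf
import Literature.AlgebraicGeometry.Frobenioids.PadicFrobenioidZero
import Literature.AnabelianGeometry.SemiGraphs.CosetCategories
import HarnessLib

/-!
# [EtTh] Def. 3.3 (iii) plumbing for the ARITHMETIC theta tower (GAP A, item GA-02): products of Def. 3.3 (iii)
# data, the coset functor `CosetCat P ⥤ P-sets`, and the Def. 3.3 (iii) data of GENUINE CONSTANTS along a field functor

S. Mochizuki, *The étale theta function …*, Publ. RIMS **45** (2009) [MochizukiEtTh2009], §3, Def. 3.3 (iii) PRIMS PDF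
p.73 («`Φ₀(Y^log) := lim Div⁺(Z^log_∞)^{Gal(Z^log_∞/Y^log)}`, `B₀(Y^log) := lim Mero(Z^log_∞)^{Gal}`, the transformation
`B₀ → Φ₀^gp` "assigning to a log-meromorphic function its log-divisor of zeroes and poles", `F₀ ⊆ B₀` "the subfunctor
determined by the constant log-meromorphic functions"»), Prop. 3.4 (ii) p.74 («`L^× ≅ F₀(Y^log)`»)
[cite: MochizukiEtTh2009, Def 3.3 p.73]; S. Mochizuki, *The geometry of Frobenioids II*, Kyushu J. Math. **62** (2008),
Ex. 1.1 (i) p.7 («`Spec(K) ↦ ord(O_K^⊳)`», «`Spec(K) ↦ K^×` … a natural homomorphism `B₀ → Φ₀^gp`»)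
[cite: MochizukiFrdII2008, Ex 1.1 (i) p.7].

abc-iut cell, GAP A = G-L5-EX32I-1 (the UNDISPUTED construction around [IUTchIII] Cor. 3.12 of the [EtTh] Def. 3.6
tempered Frobenioid at a bad place), item **GA-02** (`ArithThetaTower.divisorMonoids`, GAP-SIZING-A.md 69de97346848d3e8 §2
row D2; chair's ruled shape `plan/L5/GAP-A-SIGNATURES.md` v1 e3ccddf9b87597cf §2), seat abc-iut-gapA-02-divisorMonoids
(abc-iut-L2-t1 class).  CLASS (b) PLUMBING, consumed BY NAME and never restated: the frozen `DivisorMonoids`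
(`DivisorMonoids.lean`), abc-iut-w5-d179's base change `DivisorMonoids.precomp` (`DivisorMonoidsOfGaloisCoveringCoset.lean`),
abc-iut-L1's [FrdII] Ex. 1.1 (i) vocabulary `PadicFrd.PadicFld` / `OrdInt` / `ordIntMapOfHom` / `divUnits` / `divUnits_map` /
`PadicFrd.bZero` (`PadicValueGroupification.lean`, `PadicFrobenioidZero.lean`), abc-iut-L5-t2's `CosetCat`
(`CosetCategories.lean`).  This file provides three generic pieces the GA-02 carrier is assembled from:

* `DivisorMonoids.prod T₁ T₂` — the PRODUCT of two Def. 3.3 (iii) data over the same base: `Φ₀ = Φ₀¹ × Φ₀²`,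
  `B₀ = B₀¹ × B₀²`, `div₀ (b₁, b₂) = ι₁(div₀¹ b₁) · ι₂(div₀² b₂)` in `(Φ₀¹ × Φ₀²)^gp`, `F₀ = F₀¹ × F₀²`, (non-)cuspidal parts
  factorwise; ALL twelve fields definitions or theorems (the unique «non-cuspidal × cuspidal» decomposition is proved
  factorwise).  This is how «`Φ₀(U) := Φ₀^geom(rebase U) + ord(Ω^{aug U})·F`, `B₀(U) := (Ω^{aug U})^× · B₀^geom(rebase U)`»
  (the chair's line, RULINGS #321/#322) is typed: `+` / `·` READ AS DIRECT PRODUCT of a constant factor and a geometric factor.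
* `ArithThetaTower.cosetGSetFunctor P : CosetCat P ⥤ Action (Type 0) P`, `U ↦ P/U` with its left `P`-action — so that
  abc-iut-w6-d058's `DivisorMonoids.ofGaloisAction A hZ` (over ALL `P`-sets) restricts to the slot's SMALL base
  `T.Dv = CosetCat P` by `precomp`.
* `ArithThetaTower.ordIntFunctor p : (PadicFld p)ᵒᵖ ⥤ CommMonCat`, `Spec K ↦ ord(𝒪^▷_K)` (abc-iut-L1's `OrdInt`, BEFORE
  realification) and **`DivisorMonoids.ofPadicBase F`** — for ANY functor `F : D ⥤ PadicFld p` the Def. 3.3 (iii) data of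
  GENUINE CONSTANTS on `D`: `Φ₀(A) = ord(𝒪^▷_{F A})`, `B₀(A) = (F A)^× = F₀(A)`, `div₀ = ` abc-iut-L1's `divUnits` (natural by
  `divUnits_map`), every divisor non-cuspidal (the special fibre) — [FrdII] Ex. 1.1 (i) read as [EtTh] Def. 3.3 (iii) data.

No `Prop`-valued fact, no instance, no notation, no sorry.  HONEST FRAMING: plumbing over typed interfaces; nothing here is
the tempered Frobenioid of a Tate curve or bears on [IUTchIII] Cor. 3.12; no side taken; typed ≠ proved; NO abc claim.
-/

noncomputable section

namespace Literature.AnabelianGeometry.EtaleTheta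

open CategoryTheory Opposite Function Literature.AlgebraicGeometry.Frobenioids
  Literature.AlgebraicGeometry.Frobenioids.PadicFrd Literature.AnabelianGeometry.SemiGraphs

universe u v w

/-! ## §1 Products of Def. 3.3 (iii) data over one base -/

namespace DivisorMonoids

variable {D₀ : Type u} [Category.{v} D₀]

/-- The objectwise product of two contravariant monoid-valued functors on `D₀` (a "monoid on `D₀`" in the encoding
`D₀ᵒᵖ ⥤ CommMonCat` of [FrdI]). [cite: MochizukiEtTh2009, Def 3.3 p.73] -/
def prodFunctor (F G : D₀ᵒᵖ ⥤ CommMonCat.{w}) : D₀ᵒᵖ ⥤ CommMonCat.{w} where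
  obj Y := CommMonCat.of (F.obj Y × G.obj Y)
  map f := CommMonCat.ofHom ((F.map f).hom.prodMap (G.map f).hom)
  map_id Y := by
    refine CommMonCat.hom_ext (MonoidHom.ext fun x => ?_)
    rw [CommMonCat.hom_ofHom, MonoidHom.prodMap_def, F.map_id, G.map_id]
    rfl
  map_comp f g := by
    refine CommMonCat.hom_ext (MonoidHom.ext fun x => ?_)
    rw [CommMonCat.hom_ofHom, MonoidHom.prodMap_def, F.map_comp, G.map_comp]
    rfl

/-- `prodFunctor` on objects. [cite: MochizukiEtTh2009, Def 3.3 p.73] -/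
theorem prodFunctor_obj (F G : D₀ᵒᵖ ⥤ CommMonCat.{w}) (Y : D₀ᵒᵖ) :
    (prodFunctor F G).obj Y = CommMonCat.of (F.obj Y × G.obj Y) := rfl

/-- `prodFunctor` on morphisms, elementwise. [cite: MochizukiEtTh2009, Def 3.3 p.73] -/
@[simp] theorem prodFunctor_map_apply (F G : D₀ᵒᵖ ⥤ CommMonCat.{w}) {Y Y' : D₀ᵒᵖ} (f : Y ⟶ Y')
    (x : F.obj Y × G.obj Y) :
    ((prodFunctor F G).map f).hom x = ((F.map f).hom x.1, (G.map f).hom x.2) := rfl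

variable (T₁ T₂ : DivisorMonoids.{u, v, w} D₀)

/-- The divisor map of the product: `(b₁, b₂) ↦ ι₁(div₀¹ b₁) · ι₂(div₀² b₂)` in `(Φ₀¹(Y) × Φ₀²(Y))^gp`.
[cite: MochizukiEtTh2009, Def 3.3 p.73] -/
def prodDiv₀ (Y : D₀ᵒᵖ) :
    (T₁.B₀.obj Y × T₂.B₀.obj Y) →* Algebra.GrothendieckGroup (T₁.Φ₀.obj Y × T₂.Φ₀.obj Y) :=
  MonoidHom.coprod ((gpMap (MonoidHom.inl (T₁.Φ₀.obj Y) (T₂.Φ₀.obj Y))).comp (T₁.div₀ Y))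
    ((gpMap (MonoidHom.inr (T₁.Φ₀.obj Y) (T₂.Φ₀.obj Y))).comp (T₂.div₀ Y))

/-- `prodDiv₀` on elements. [cite: MochizukiEtTh2009, Def 3.3 p.73] -/
theorem prodDiv₀_apply (Y : D₀ᵒᵖ) (b : T₁.B₀.obj Y × T₂.B₀.obj Y) :
    prodDiv₀ T₁ T₂ Y b = gpMap (MonoidHom.inl _ _) (T₁.div₀ Y b.1) * gpMap (MonoidHom.inr _ _) (T₂.div₀ Y b.2) :=
  rfl

/-- **The product of two Def. 3.3 (iii) data over the same base** (all fields factorwise; every law PROVED from the laws of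
the factors). [cite: MochizukiEtTh2009, Def 3.3 p.73] -/
def prod : DivisorMonoids.{u, v, w} D₀ where
  Φ₀ := prodFunctor T₁.Φ₀ T₂.Φ₀
  B₀ := prodFunctor T₁.B₀ T₂.B₀
  isUnit_B₀ Y b := Prod.isUnit_iff.mpr ⟨T₁.isUnit_B₀ Y b.1, T₂.isUnit_B₀ Y b.2⟩
  div₀ := prodDiv₀ T₁ T₂
  div₀_natural {Y Y'} f b := by
    change prodDiv₀ T₁ T₂ Y' ((T₁.B₀.map f).hom b.1, (T₂.B₀.map f).hom b.2) =
      gpMap ((T₁.Φ₀.map f).hom.prodMap (T₂.Φ₀.map f).hom) (prodDiv₀ T₁ T₂ Y b)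
    have e₁ : ((T₁.Φ₀.map f).hom.prodMap (T₂.Φ₀.map f).hom).comp (MonoidHom.inl _ _) =
        (MonoidHom.inl _ _).comp (T₁.Φ₀.map f).hom :=
      MonoidHom.ext fun a => Prod.ext rfl (map_one (T₂.Φ₀.map f).hom)
    have e₂ : ((T₁.Φ₀.map f).hom.prodMap (T₂.Φ₀.map f).hom).comp (MonoidHom.inr _ _) =
        (MonoidHom.inr _ _).comp (T₂.Φ₀.map f).hom :=
      MonoidHom.ext fun a => Prod.ext (map_one (T₁.Φ₀.map f).hom) rfl
    rw [prodDiv₀_apply, prodDiv₀_apply, T₁.div₀_natural, T₂.div₀_natural, map_mul, ← gpMap_comp_apply'',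
      ← gpMap_comp_apply'', ← gpMap_comp_apply'', ← gpMap_comp_apply'', e₁, e₂]
  F₀ Y := (T₁.F₀ Y).prod (T₂.F₀ Y)
  F₀_map f b hb := ⟨T₁.F₀_map f b.1 hb.1, T₂.F₀_map f b.2 hb.2⟩
  ncsp₀ Y := (T₁.ncsp₀ Y).prod (T₂.ncsp₀ Y)
  csp₀ Y := (T₁.csp₀ Y).prod (T₂.csp₀ Y)
  ncsp₀_map f x hx := ⟨T₁.ncsp₀_map f x.1 hx.1, T₂.ncsp₀_map f x.2 hx.2⟩
  csp₀_map f x hx := ⟨T₁.csp₀_map f x.1 hx.1, T₂.csp₀_map f x.2 hx.2⟩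
  existsUnique_ncsp_csp Y x := by
    obtain ⟨p₁, hp₁, hu₁⟩ := T₁.existsUnique_ncsp_csp Y x.1
    obtain ⟨p₂, hp₂, hu₂⟩ := T₂.existsUnique_ncsp_csp Y x.2
    refine ⟨(⟨(p₁.1.1, p₂.1.1), ⟨p₁.1.2, p₂.1.2⟩⟩, ⟨(p₁.2.1, p₂.2.1), ⟨p₁.2.2, p₂.2.2⟩⟩), Prod.ext hp₁ hp₂, ?_⟩
    rintro ⟨⟨n, hn⟩, ⟨c, hc⟩⟩ h
    have h₁ : ((⟨n.1, hn.1⟩ : T₁.ncsp₀ Y) : T₁.Φ₀.obj Y) * ((⟨c.1, hc.1⟩ : T₁.csp₀ Y) : T₁.Φ₀.obj Y) = x.1 :=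
      congrArg Prod.fst h
    have h₂ : ((⟨n.2, hn.2⟩ : T₂.ncsp₀ Y) : T₂.Φ₀.obj Y) * ((⟨c.2, hc.2⟩ : T₂.csp₀ Y) : T₂.Φ₀.obj Y) = x.2 :=
      congrArg Prod.snd h
    have e₁ := hu₁ (⟨n.1, hn.1⟩, ⟨c.1, hc.1⟩) h₁
    have e₂ := hu₂ (⟨n.2, hn.2⟩, ⟨c.2, hc.2⟩) h₂
    have en₁ : n.1 = p₁.1.1 := congrArg (fun q => (q.1 : T₁.Φ₀.obj Y)) e₁
    have ec₁ : c.1 = p₁.2.1 := congrArg (fun q => (q.2 : T₁.Φ₀.obj Y)) e₁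
    have en₂ : n.2 = p₂.1.1 := congrArg (fun q => (q.1 : T₂.Φ₀.obj Y)) e₂
    have ec₂ : c.2 = p₂.2.1 := congrArg (fun q => (q.2 : T₂.Φ₀.obj Y)) e₂
    exact Prod.ext (Subtype.ext (Prod.ext en₁ en₂)) (Subtype.ext (Prod.ext ec₁ ec₂))

/-- `Φ₀` of the product, on objects. [cite: MochizukiEtTh2009, Def 3.3 p.73] -/
theorem prod_Φ₀_obj (Y : D₀ᵒᵖ) : (T₁.prod T₂).Φ₀.obj Y = CommMonCat.of (T₁.Φ₀.obj Y × T₂.Φ₀.obj Y) := rfl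

/-- `B₀` of the product, on objects. [cite: MochizukiEtTh2009, Def 3.3 p.73] -/
theorem prod_B₀_obj (Y : D₀ᵒᵖ) : (T₁.prod T₂).B₀.obj Y = CommMonCat.of (T₁.B₀.obj Y × T₂.B₀.obj Y) := rfl

/-- `Φ₀` of the product, on morphisms. [cite: MochizukiEtTh2009, Def 3.3 p.73] -/
theorem prod_Φ₀_map_apply {Y Y' : D₀ᵒᵖ} (f : Y ⟶ Y') (x : T₁.Φ₀.obj Y × T₂.Φ₀.obj Y) :
    ((T₁.prod T₂).Φ₀.map f).hom x = ((T₁.Φ₀.map f).hom x.1, (T₂.Φ₀.map f).hom x.2) := rfl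

/-- `B₀` of the product, on morphisms. [cite: MochizukiEtTh2009, Def 3.3 p.73] -/
theorem prod_B₀_map_apply {Y Y' : D₀ᵒᵖ} (f : Y ⟶ Y') (b : T₁.B₀.obj Y × T₂.B₀.obj Y) :
    ((T₁.prod T₂).B₀.map f).hom b = ((T₁.B₀.map f).hom b.1, (T₂.B₀.map f).hom b.2) := rfl

/-- `div₀` of the product. [cite: MochizukiEtTh2009, Def 3.3 p.73] -/
theorem prod_div₀_apply (Y : D₀ᵒᵖ) (b : T₁.B₀.obj Y × T₂.B₀.obj Y) :
    (T₁.prod T₂).div₀ Y b =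
      gpMap (MonoidHom.inl _ _) (T₁.div₀ Y b.1) * gpMap (MonoidHom.inr _ _) (T₂.div₀ Y b.2) := rfl

/-- `F₀` of the product. [cite: MochizukiEtTh2009, Def 3.3 p.73] -/
theorem prod_F₀ (Y : D₀ᵒᵖ) : (T₁.prod T₂).F₀ Y = (T₁.F₀ Y).prod (T₂.F₀ Y) := rfl

/-- `ncsp₀` of the product. [cite: MochizukiEtTh2009, Def 3.3 p.73] -/
theorem prod_ncsp₀ (Y : D₀ᵒᵖ) : (T₁.prod T₂).ncsp₀ Y = (T₁.ncsp₀ Y).prod (T₂.ncsp₀ Y) := rfl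

/-- `csp₀` of the product. [cite: MochizukiEtTh2009, Def 3.3 p.73] -/
theorem prod_csp₀ (Y : D₀ᵒᵖ) : (T₁.prod T₂).csp₀ Y = (T₁.csp₀ Y).prod (T₂.csp₀ Y) := rfl

end DivisorMonoids

/-! ## §2 The coset functor `CosetCat P ⥤ P-sets` -/

namespace ArithThetaTower

variable (P : Type) [Group P] [TopologicalSpace P]

/-- **`U ↦ P/U`**: the object `U` of the small coset category (standing for the connected covering `P/U`) as a
`P`-set with its left action ([FrdII] Ex. 1.3 (i) «the set of cosets `Π/Π°` equipped with its natural `Π`-action from the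
left»); morphisms go to themselves. [cite: MochizukiFrdII2008, Ex 1.3 (i) p.11] -/
def cosetGSetFunctor : CosetCat P ⥤ Action (Type 0) P where
  obj U := Action.ofMulAction P U.carrier
  map {U V} f :=
    { hom := TypeCat.ofHom (CosetCat.Hom.toFun f)
      comm := fun g => by
        refine ConcreteCategory.hom_ext _ _ fun x => ?_
        change CosetCat.Hom.toFun f ((Action.ofMulAction P U.carrier).ρ g x) =
          (Action.ofMulAction P V.carrier).ρ g (CosetCat.Hom.toFun f x)
        rw [Action.ofMulAction_apply, Action.ofMulAction_apply, f.map_smul] }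
  map_id U := Action.hom_ext _ _ (ConcreteCategory.hom_ext _ _ fun _ => rfl)
  map_comp f g := Action.hom_ext _ _ (ConcreteCategory.hom_ext _ _ fun _ => rfl)

/-- `cosetGSetFunctor` on objects: the `P`-set `P/U`. [cite: MochizukiFrdII2008, Ex 1.3 (i) p.11] -/
theorem cosetGSetFunctor_obj (U : CosetCat P) : (cosetGSetFunctor P).obj U = Action.ofMulAction P U.carrier := rfl

/-- `cosetGSetFunctor` on morphisms, pointwise. [cite: MochizukiFrdII2008, Ex 1.3 (i) p.11] -/
@[simp] theorem cosetGSetFunctor_map_hom_apply {U V : CosetCat P} (f : U ⟶ V) (x : U.carrier) :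
    ((cosetGSetFunctor P).map f).hom x = CosetCat.Hom.toFun f x := rfl

/-- Every `P/U` is a CONNECTED `P`-set (nonempty, one orbit): the coset functor lands in Def. 3.3's `D₀` at this term.
[cite: MochizukiEtTh2009, Def 3.3 p.73] -/
theorem isConnectedGSet_cosetGSetFunctor_obj (U : CosetCat P) :
    LogDivisorModel.GaloisAction.isConnectedGSet ((cosetGSetFunctor P).obj U) :=
  LogDivisorModel.GaloisAction.isConnectedGSet_quotient U.sg.toSubgroup

/-- Morphisms `P/U → P/V` are surjective. [cite: MochizukiEtTh2009, Def 3.3 p.73] -/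
theorem cosetGSetFunctor_map_surjective {U V : CosetCat P} (f : U ⟶ V) :
    Function.Surjective ((cosetGSetFunctor P).map f).hom :=
  LogDivisorModel.GaloisAction.hom_surjective_of_isConnectedGSet (isConnectedGSet_cosetGSetFunctor_obj P U)
    (isConnectedGSet_cosetGSetFunctor_obj P V) _

/-! ## §3 The Def. 3.3 (iii) data of genuine constants along a field functor -/

variable (p : ℕ)

/-- **`Spec K ↦ ord(𝒪^▷_K)`** ([FrdII] Ex. 1.1 (i), BEFORE realification) as a functor `(PadicFld p)ᵒᵖ ⥤ CommMonCat`;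
restriction maps abc-iut-L1's `ordIntMapOfHom`. [cite: MochizukiFrdII2008, Ex 1.1 (i) p.7] -/
def ordIntFunctor : (PadicFld.{0} p)ᵒᵖ ⥤ CommMonCat.{0} where
  obj X := CommMonCat.of (OrdInt X.unop.K)
  map f := CommMonCat.ofHom (ordIntMapOfHom f.unop.alg f.unop.isValHom)
  map_id X := by
    apply CommMonCat.hom_ext
    rw [CommMonCat.hom_ofHom, CommMonCat.hom_id]
    exact ordIntMapOfHom_id _
  map_comp f g := by
    apply CommMonCat.hom_ext
    rw [CommMonCat.hom_ofHom, CommMonCat.hom_comp, CommMonCat.hom_ofHom, CommMonCat.hom_ofHom]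
    exact ordIntMapOfHom_comp g.unop.alg g.unop.isValHom f.unop.alg f.unop.isValHom _

/-- `ordIntFunctor` on objects. [cite: MochizukiFrdII2008, Ex 1.1 (i) p.7] -/
theorem ordIntFunctor_obj (X : (PadicFld.{0} p)ᵒᵖ) : (ordIntFunctor p).obj X = CommMonCat.of (OrdInt X.unop.K) := rfl

/-- `ordIntFunctor` on morphisms. [cite: MochizukiFrdII2008, Ex 1.1 (i) p.7] -/
theorem ordIntFunctor_map_hom {X Y : (PadicFld.{0} p)ᵒᵖ} (f : X ⟶ Y) :
    ((ordIntFunctor p).map f).hom = ordIntMapOfHom f.unop.alg f.unop.isValHom := rfl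

/-- abc-iut-L1's `gpMapOfHom` IS `gpMap (ordIntMapOfHom …)` (same definition). [cite: MochizukiFrdII2008, Ex 1.1 (i) p.7] -/
theorem gpMapOfHom_eq_gpMap {K L : Type} [Field K] [ValuativeRel K] [Field L] [ValuativeRel L] (σ : L →+* K)
    (hσ : IsValHom σ) : gpMapOfHom σ hσ = gpMap (ordIntMapOfHom σ hσ) := rfl

end ArithThetaTower

namespace DivisorMonoids

variable {p : ℕ} {D : Type u} [Category.{v} D] (F : D ⥤ PadicFld.{0} p)

/-- **The Def. 3.3 (iii) data of GENUINE CONSTANTS along a field functor `F : D ⥤ PadicFld p`** (`A ↦ Spec L_A`):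
`Φ₀(A) := ord(𝒪^▷_{L_A})` (multiples of the special fibre, measured in the genuine value monoid), `B₀(A) := L_A^×`,
`div₀ := ` the valuation `L_A^× → ord(L_A^×) = ord(𝒪^▷_{L_A})^gp` (abc-iut-L1's `divUnits`, natural by `divUnits_map`),
`F₀(A) := L_A^×` (every constant is constant: Prop. 3.4 (ii) «`L^× ≅ F₀`»), every divisor NON-CUSPIDAL (supported on the
special fibre).  [FrdII] Ex. 1.1 (i)'s `(Φ₀, B₀, B₀ → Φ₀^gp)` read as [EtTh] Def. 3.3 (iii) data.
[cite: MochizukiEtTh2009, Def 3.3 p.73] -/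
def ofPadicBase : DivisorMonoids.{u, v, 0} D where
  Φ₀ := F.op ⋙ ArithThetaTower.ordIntFunctor p
  B₀ := F.op ⋙ PadicFrd.bZero p
  isUnit_B₀ Y b := by
    change IsUnit (M := ((F.obj Y.unop).K)ˣ) b
    exact Group.isUnit _
  div₀ Y := divUnits (F.obj Y.unop).K
  div₀_natural {Y Y'} f b := by
    change divUnits (F.obj Y'.unop).K (Units.map ((F.map f.unop).alg : (F.obj Y.unop).K →* (F.obj Y'.unop).K) b) =
      gpMap (ordIntMapOfHom (F.map f.unop).alg (F.map f.unop).isValHom) (divUnits (F.obj Y.unop).K b)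
    rw [divUnits_map (F.map f.unop).alg (F.map f.unop).isValHom]
    rfl
  F₀ Y := ⊤
  F₀_map _ _ _ := trivial
  ncsp₀ Y := ⊤
  csp₀ Y := ⊥
  ncsp₀_map _ _ _ := trivial
  csp₀_map f x hx := by
    rw [Submonoid.mem_bot] at hx
    rw [hx, map_one]
    exact Submonoid.one_mem _
  existsUnique_ncsp_csp Y x := by
    refine ⟨(⟨x, trivial⟩, ⟨1, Submonoid.one_mem _⟩), mul_one x, ?_⟩
    rintro ⟨n, c⟩ h
    have hc : (c : (F.op ⋙ ArithThetaTower.ordIntFunctor p).obj Y) = 1 := Submonoid.mem_bot.mp c.2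
    have hn : (n : (F.op ⋙ ArithThetaTower.ordIntFunctor p).obj Y) = x := by
      have h' := h
      rw [hc, mul_one] at h'
      exact h'
    exact Prod.ext (Subtype.ext hn) (Subtype.ext hc)

/-- `Φ₀` of the constants data, on objects. [cite: MochizukiEtTh2009, Def 3.3 p.73] -/
theorem ofPadicBase_Φ₀_obj (Y : Dᵒᵖ) : (ofPadicBase F).Φ₀.obj Y = CommMonCat.of (OrdInt (F.obj Y.unop).K) := rfl

/-- `B₀` of the constants data, on objects: the unit group of the field. [cite: MochizukiEtTh2009, Def 3.3 p.73] -/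
theorem ofPadicBase_B₀_obj (Y : Dᵒᵖ) : (ofPadicBase F).B₀.obj Y = CommMonCat.of ((F.obj Y.unop).K)ˣ := rfl

/-- `Φ₀` of the constants data, on morphisms. [cite: MochizukiEtTh2009, Def 3.3 p.73] -/
theorem ofPadicBase_Φ₀_map_hom {Y Y' : Dᵒᵖ} (f : Y ⟶ Y') :
    ((ofPadicBase F).Φ₀.map f).hom = ordIntMapOfHom (F.map f.unop).alg (F.map f.unop).isValHom := rfl

/-- `B₀` of the constants data, on morphisms. [cite: MochizukiEtTh2009, Def 3.3 p.73] -/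
theorem ofPadicBase_B₀_map_hom {Y Y' : Dᵒᵖ} (f : Y ⟶ Y') :
    ((ofPadicBase F).B₀.map f).hom = Units.map ((F.map f.unop).alg : (F.obj Y.unop).K →* (F.obj Y'.unop).K) := rfl

/-- `div₀` of the constants data is the valuation `divUnits`. [cite: MochizukiEtTh2009, Def 3.3 p.73] -/
theorem ofPadicBase_div₀ (Y : Dᵒᵖ) : (ofPadicBase F).div₀ Y = divUnits (F.obj Y.unop).K := rfl

/-- `F₀ = B₀` for the constants data. [cite: MochizukiEtTh2009, Prop 3.4 p.74] -/
theorem ofPadicBase_F₀ (Y : Dᵒᵖ) : (ofPadicBase F).F₀ Y = ⊤ := rfl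

/-- Every divisor of the constants data is non-cuspidal. [cite: MochizukiEtTh2009, Def 3.3 p.73] -/
theorem ofPadicBase_ncsp₀ (Y : Dᵒᵖ) : (ofPadicBase F).ncsp₀ Y = ⊤ := rfl

/-- No divisor of the constants data is cuspidal. [cite: MochizukiEtTh2009, Def 3.3 p.73] -/
theorem ofPadicBase_csp₀ (Y : Dᵒᵖ) : (ofPadicBase F).csp₀ Y = ⊥ := rfl

/-- **Prop. 3.4 (ii) for the constants data, first clause**: a constant with trivial divisor is a constant (trivially,
`F₀ = B₀`). [cite: MochizukiEtTh2009, Prop 3.4 p.74] -/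
theorem ofPadicBase_ker_div₀_le_F₀ (Y : Dᵒᵖ) (b : (ofPadicBase F).B₀.obj Y) (_h : (ofPadicBase F).div₀ Y b = 1) :
    b ∈ (ofPadicBase F).F₀ Y := trivial

/-- The kernel of `div₀` of the constants data is EXACTLY the unit group `𝒪^×_{L_A}` (abc-iut-L1's `ker_divUnits`).
[cite: MochizukiFrdII2008, Ex 1.1 (i) p.7] -/
theorem ofPadicBase_div₀_eq_one_iff (Y : Dᵒᵖ) (b : ((F.obj Y.unop).K)ˣ) :
    (ofPadicBase F).div₀ Y b = 1 ↔ b ∈ unitSubgroup (F.obj Y.unop).K := by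
  change divUnits (F.obj Y.unop).K b = 1 ↔ _
  rw [← MonoidHom.mem_ker, ker_divUnits]

end DivisorMonoids

end Literature.AnabelianGeometry.EtaleTheta

end
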